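/-
Copyright (c) 2026 the pub-hodgecm-mathlib formalisation cell (harness21).  Prover seat hodgecm-mathlib-LH7-p02 (g3), 2026-09-02 (line LH7, closer row `stub_PKtupleK2`,
#181 III-127; h413 = stmt-HodgeConjecture-24833; leaf `Cruxes/H413/Lines/F0_P3c_PKtuplePaydown.lean` ED. 3, organ `stub_PKsaU2 : PKsaU2Shape L` (O8a), in-house road
`F0/P3a/F0P3a-p03/g21/CENSUS-O8a-PKsaU2`, steps (1)+(2) «a place where the realised class is a character ⇒ `SU(Φ₂)(L⁺_v)` fixes `P`» — the socket feeding the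
strong-approximation step of the (6) assembly of F0P3a-p04 (g23)).
-/
import Summits.HodgeConjecture.HodgeConjecture.Theorems.F0P3cPKtupleU1Line          -- ★ (γ′) `comap_mk_ofChar`, `isOpen_ker_comp_equiv`; brings ★ `F0P3GlobalPacketDiscrete` (`cmOccursInDiscreteSpectrum`), the `cmDatum` ∕ `localPiEquiv` currency
import Literature.NumberTheory.Automorphic.UnitaryGroupRankTwoLocalCharacterIsotypy   -- ★ p850555 `apply_inclPlace_eq_smul_of_forall_isConstituentOf_eq_of_injective` (unique character constituent ⇒ all of `U(Φ₂)(L⁺_v)` acts by `χ_v`)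
import Literature.NumberTheory.Automorphic.DiscreteAutomorphicRepConjStableFixed       -- ★ p850597 `DiscreteAutomorphicRep.toContRep_inclPlaceAdelic_apply_eq_self_of_forall_det_eq_one` (`SU_v` trivial on a finite component ⇒ on `P`)
import Literature.NumberTheory.Automorphic.UnitaryGroupAdelicCharactersDetQuasiSplit  -- ★ `AdelicCharactersDetQuasiSplit.localPi_apply_eq_one` (characters of `U(J_N)(L⁺_v)` kill the determinant-one elements, Dieudonné)
import Literature.NumberTheory.Automorphic.LocalUnitaryGroupCongr                     -- ★ `antidiagOne_eq_over` (the H413 literal `Φ₂` IS `(StdForm.antidiagonal 2).over L`)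
import Literature.NumberTheory.Automorphic.IrreducibleClassesConstituents              -- ★ `IrrClass.nontrivial_of_isIrreducible`
import HarnessLib

/-!
# LH7 ∕ O8a steps (1)+(2): at a finite place where the realised class of `π₂` is a CHARACTER, `SU(Φ₂)(L⁺_v)` fixes the finite component — hence every vector of `P`
# ([Rogawski1990] §13.3 pp. 202–203; [Dieudonne1971GroupesClassiques] Chap. II §5; [BorelJacquet1979] §4.6)

Cell `hodgecm-mathlib` (D-0151), crux H413 = `stmt-HodgeConjecture-24833`, line LH7, letter O8a `PKsaU2Shape` (★ `Theorems/F0P3cPKtupleHSideLetters`).  THEOREMS ONLY (kernel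
lane `--kind proof --supports stmt-HodgeConjecture-24833 --as helper`): no `def`, no instance, no notation, no named fact, no `sorry`.

THE MATHEMATICS.  Let `P` be a discrete automorphic representation of the quasi-split `U(Φ₂)_{L∕L⁺}` (`Φ₂ = antidiag(1,1)` in the H413 literal spelling), `σ ↪ P|_{U(Φ₂)(𝔸_f)}` a SMOOTH
representation with an injective intertwiner `ι`, whose constituents at every finite `v` are exactly `comap (localPiEquiv v) (π₂ v)` (the body of ★ `cmOccursInDiscreteSpectrum`), and let `v₁`
be a finite place where `π₂ v₁ = ⟦ℂ_{χ'}⟧` is the class of a smooth character `χ'` of `U(Φ₂)(L⁺_{v₁})` (the letter's cofinite hypothesis, at one place).  Then: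
(§1) every homomorphism from the Π-model `U(Φ₂)(L⁺_v)` to an abelian group kills the elements all of whose components have determinant `1` — ★
`AdelicCharactersDetQuasiSplit.localPi_apply_eq_one` (Dieudonné: `SU` of the isotropic form is generated by transvections; split `v`: `GL₂`-commutators), read in the literal
spelling of `Φ₂` through ★ `antidiagOne_eq_over`; (§2) along ★ `localPiEquiv v₁` the unique constituent is `⟦ℂ_{χ' ∘ localPiEquiv v₁}⟧` (★ `comap_mk_ofChar`), so by ★ p850555 ALL of
`U(Φ₂)(L⁺_{v₁})` acts on `W_σ` through `χ' ∘ localPiEquiv v₁`, and by §1 the determinant-one elements act TRIVIALLY on `W_σ`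
(`forall_apply_inclPlace_eq_self_of_eq_mk_ofChar`); (§3) by ★ p850597 they act trivially on EVERY vector of `P`
(`forall_toContRep_inclPlaceAdelic_apply_eq_self_of_eq_mk_ofChar`) — the `hfix` input of the strong-approximation step (★ p850740 `…_of_subset_closure` with
`S₁ := inclPlaceAdelic v₁ '' {u | ∀ w, det u_w = 1}`, `hdense` := ★ p850697∕p850725).

HONEST LABEL: count-neutral in-house glue; HC_CM is proved only modulo the 7 printed citations (2 remaining: hLiu418 = stmt-HodgeConjecture-24832, h413 = stmt-HodgeConjecture-24833)
until rung 0 closes.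

## References
* [Rogawski1990] J. D. Rogawski, *Automorphic Representations of Unitary Groups in Three Variables*, Ann. of Math. Stud. 123 (1990), §13.3 pp. 202–203.
* [Dieudonne1971GroupesClassiques] J. Dieudonné, *La géométrie des groupes classiques*, 3e éd. (1971), Chap. II §5.
* [BorelJacquet1979] A. Borel, H. Jacquet, *Automorphic forms and automorphic representations*, PSPM 33.1 (1979), §4.6.
* [PlatonovRapinchuk1994] V. Platonov, A. Rapinchuk, *Algebraic Groups and Number Theory* (1994), §7.4 (the role of `SU_{v₁}` in Kneser's argument).
-/

set_option autoImplicit false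
-- the mandated namespace repeats the single-problem summit's segment (`HodgeConjecture.HodgeConjecture`)
set_option linter.dupNamespace false

noncomputable section

namespace Summit.HodgeConjecture.HodgeConjecture.Cruxes.H413.F0P3cPKtupleSaU2LocalFix

open MeasureTheory NumberField IsDedekindDomain
open Literature.NumberTheory.Automorphic Literature.NumberTheory.Automorphic.UnitaryGroup
open Literature.NumberTheory.Rogawski1990 Literature.NumberTheory.GaloisRepresentations
open Literature.NumberTheory.Automorphic.Arthur2013.Leaves.TECR
open Summit.HodgeConjecture.HodgeConjecture.Cruxes.H413.F0P3GlobalPacketDiscrete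
open Summit.HodgeConjecture.HodgeConjecture.Cruxes.H413.F0P3cPKtupleU1Line

universe u

variable {L : Type} [Field L] [NumberField L] [IsCMField L]

/-! ## §1 Characters of `U(Φ)(L⁺_v)` kill the determinant-one elements (Dieudonné), in the literal spelling of `Φ₂` -/

/-- **Every homomorphism `U(Φ)(L⁺_v) →* A` to an abelian group kills the elements all of whose components have determinant one**, for any `Φ = (StdForm.antidiagonal 2).over L`
(★ `AdelicCharactersDetQuasiSplit.localPi_apply_eq_one` at `N = 2`, transported along the equality of forms). [cite: Dieudonne1971GroupesClassiques, Chap. II §5] -/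
theorem localPi_apply_eq_one_of_eq_antidiagonal_two {A : Type*} [CommGroup A] (Φ : Matrix (Fin 2) (Fin 2) L) (hΦ : Φ = (StdForm.antidiagonal 2).over L)
    (v : HeightOneSpectrum (𝓞 ↥(maximalRealSubfield L))) (θ : ↥(localPi L (IsCMField.complexConj L) 2 Φ v) →* A) (u : ↥(localPi L (IsCMField.complexConj L) 2 Φ v))
    (hu : ∀ w : PlacesOver L v, (((u : LocalGLPi L 2 v) w : GL (Fin 2) (w.1.adicCompletion L)) : Matrix (Fin 2) (Fin 2) (w.1.adicCompletion L)).det = 1) :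
    θ u = 1 := by
  subst hΦ
  exact AdelicCharactersDetQuasiSplit.localPi_apply_eq_one L (le_refl 2) v θ u hu

/-- **The same for the H413 literal `Φ₂ = (i, j) ↦ [i + j + 1 = 2]`** (★ `antidiagOne_eq_over L 2`). [cite: Dieudonne1971GroupesClassiques, Chap. II §5] -/
theorem localPi_apply_eq_one_antidiagOne_two {A : Type*} [CommGroup A] (v : HeightOneSpectrum (𝓞 ↥(maximalRealSubfield L)))
    (θ : ↥(localPi L (IsCMField.complexConj L) 2 (Matrix.of fun i j : Fin 2 => if i.val + j.val + 1 = 2 then (1 : L) else 0) v) →* A)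
    (u : ↥(localPi L (IsCMField.complexConj L) 2 (Matrix.of fun i j : Fin 2 => if i.val + j.val + 1 = 2 then (1 : L) else 0) v))
    (hu : ∀ w : PlacesOver L v, (((u : LocalGLPi L 2 v) w : GL (Fin 2) (w.1.adicCompletion L)) : Matrix (Fin 2) (Fin 2) (w.1.adicCompletion L)).det = 1) :
    θ u = 1 :=
  localPi_apply_eq_one_of_eq_antidiagonal_two _ (antidiagOne_eq_over L 2) v θ u hu

/-! ## §2 A character place: `SU(Φ₂)(L⁺_{v₁})` fixes the finite component `σ` -/

/-- **At a place `v₁` where the realised class is a character, `SU(Φ₂)(L⁺_{v₁})` fixes the finite component.**  `P` discrete automorphic of `U(Φ₂)`, `σ` SMOOTH with an injective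
intertwiner `ι : σ → P|_{U(Φ₂)(𝔸_f)}`, constituents of `σ ∘ inclPlace v₁` exactly `comap (localPiEquiv v₁) (π₂ v₁)`, and `π₂ v₁ = ⟦ℂ_{χ'}⟧`; then `σ (inclPlace v₁ u) w = w` for every
`u ∈ U(Φ₂)(L⁺_{v₁})` all of whose components have determinant `1` and every `w ∈ W_σ` (★ p850555: all of `U(Φ₂)(L⁺_{v₁})` acts by `χ' ∘ localPiEquiv v₁`; §1: that character
kills `u`). [cite: Rogawski1990, §13.3 pp. 202–203] [cite: Dieudonne1971GroupesClassiques, Chap. II §5] -/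
theorem forall_apply_inclPlace_eq_self_of_eq_mk_ofChar
    {μ₂ : Measure (adelicGroupData ↥(maximalRealSubfield L) L (IsCMField.complexConj L) 2 (Matrix.of fun i j : Fin 2 => if i.val + j.val + 1 = 2 then (1 : L) else 0)).automorphicQuotient}
    [(adelicGroupData ↥(maximalRealSubfield L) L (IsCMField.complexConj L) 2 (Matrix.of fun i j : Fin 2 => if i.val + j.val + 1 = 2 then (1 : L) else 0)).IsAutomorphicMeasure μ₂]
    (π₂ : ∀ v : HeightOneSpectrum (𝓞 ↥(maximalRealSubfield L)), IrrClass ((cmDatum L 2 (Matrix.of fun i j : Fin 2 => if i.val + j.val + 1 = 2 then (1 : L) else 0)).Local v))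
    (P : DiscreteAutomorphicRep (adelicGroupData ↥(maximalRealSubfield L) L (IsCMField.complexConj L) 2 (Matrix.of fun i j : Fin 2 => if i.val + j.val + 1 = 2 then (1 : L) else 0)) μ₂)
    {W : Type} [AddCommGroup W] [Module ℂ W]
    (σ : Representation ℂ (finAdelic ↥(maximalRealSubfield L) L (IsCMField.complexConj L) 2 (Matrix.of fun i j : Fin 2 => if i.val + j.val + 1 = 2 then (1 : L) else 0)) W)
    (hsm : σ.IsSmooth) (ι : σ.IntertwiningMap P.finRep) (hι : Function.Injective ι)
    (v₁ : HeightOneSpectrum (𝓞 ↥(maximalRealSubfield L)))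
    (hconst : ∀ c₀ : IrrClass ↥(localPi L (IsCMField.complexConj L) 2 (Matrix.of fun i j : Fin 2 => if i.val + j.val + 1 = 2 then (1 : L) else 0) v₁),
      c₀.IsConstituentOf (σ.comp (inclPlace ↥(maximalRealSubfield L) L (IsCMField.complexConj L) 2 (Matrix.of fun i j : Fin 2 => if i.val + j.val + 1 = 2 then (1 : L) else 0) v₁)) ↔
        c₀ = IrrClass.comap (localPiEquiv L (IsCMField.complexConj L) 2 (Matrix.of fun i j : Fin 2 => if i.val + j.val + 1 = 2 then (1 : L) else 0) v₁) (π₂ v₁))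
    (χ' : (cmDatum L 2 (Matrix.of fun i j : Fin 2 => if i.val + j.val + 1 = 2 then (1 : L) else 0)).Local v₁ →* ℂˣ)
    (hχ' : IsOpen ((χ'.ker : Subgroup ((cmDatum L 2 (Matrix.of fun i j : Fin 2 => if i.val + j.val + 1 = 2 then (1 : L) else 0)).Local v₁)) :
      Set ((cmDatum L 2 (Matrix.of fun i j : Fin 2 => if i.val + j.val + 1 = 2 then (1 : L) else 0)).Local v₁)))
    (hv : π₂ v₁ = IrrClass.mk (SmoothIrrep.ofChar χ' hχ'))
    (u : ↥(localPi L (IsCMField.complexConj L) 2 (Matrix.of fun i j : Fin 2 => if i.val + j.val + 1 = 2 then (1 : L) else 0) v₁))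
    (hu : ∀ w : PlacesOver L v₁, (((u : LocalGLPi L 2 v₁) w : GL (Fin 2) (w.1.adicCompletion L)) : Matrix (Fin 2) (Fin 2) (w.1.adicCompletion L)).det = 1) (w : W) :
    σ (inclPlace ↥(maximalRealSubfield L) L (IsCMField.complexConj L) 2 (Matrix.of fun i j : Fin 2 => if i.val + j.val + 1 = 2 then (1 : L) else 0) v₁ u) w = w := by
  set e := localPiEquiv L (IsCMField.complexConj L) 2 (Matrix.of fun i j : Fin 2 => if i.val + j.val + 1 = 2 then (1 : L) else 0) v₁ with he
  -- the unique constituent along `e` is `⟦χ' ∘ e⟧`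
  have hχe := isOpen_ker_comp_equiv e χ' hχ'
  have hconst' : ∀ c₀ : IrrClass ↥(localPi L (IsCMField.complexConj L) 2 (Matrix.of fun i j : Fin 2 => if i.val + j.val + 1 = 2 then (1 : L) else 0) v₁),
      c₀.IsConstituentOf (σ.comp (inclPlace ↥(maximalRealSubfield L) L (IsCMField.complexConj L) 2 (Matrix.of fun i j : Fin 2 => if i.val + j.val + 1 = 2 then (1 : L) else 0) v₁)) →
        c₀ = IrrClass.mk (SmoothIrrep.ofChar (χ'.comp e.toMonoidHom) hχe) := fun c₀ hc₀ => by
    have h1 : c₀ = IrrClass.comap e (π₂ v₁) := (hconst c₀).1 hc₀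
    have h2 : IrrClass.comap e (IrrClass.mk (SmoothIrrep.ofChar χ' hχ')) = IrrClass.mk (SmoothIrrep.ofChar (χ'.comp e.toMonoidHom) hχe) :=
      comap_mk_ofChar e χ' hχ' hχe
    rw [hv] at h1
    exact h1.trans h2
  -- ★ p850555: all of `U(Φ₂)(L⁺_{v₁})` acts on `W` through `χ' ∘ e`
  have hJ2 : (Matrix.of fun i j : Fin 2 => if i.val + j.val + 1 = 2 then (1 : L) else 0) = !![0, 1; 1, 0] := by
    ext i j; fin_cases i <;> fin_cases j <;> rfl
  have hact := apply_inclPlace_eq_smul_of_forall_isConstituentOf_eq_of_injective L (IsCMField.complexConj L) (IsCMField.complexConj_ne_one (K := L)) hJ2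
    P σ hsm ι hι v₁ (χ'.comp e.toMonoidHom) hχe hconst' u w
  -- §1: the character kills `u`
  rw [hact, localPi_apply_eq_one_antidiagOne_two v₁ (χ'.comp e.toMonoidHom) u hu, Units.val_one, one_smul]

/-! ## §3 … hence `SU(Φ₂)(L⁺_{v₁})` fixes every vector of `P` -/

/-- **At a place `v₁` where the realised class is a character, `SU(Φ₂)(L⁺_{v₁})` fixes EVERY vector of `P`**: `R(ι_{v₁} u) f = f` for all `f ∈ P` and all `u ∈ U(Φ₂)(L⁺_{v₁})` whose
components have determinant `1` (§2 + ★ p850597 `toContRep_inclPlaceAdelic_apply_eq_self_of_forall_det_eq_one`, `σ` irreducible hence `W ≠ 0`).  This is the `hfix` input of the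
strong-approximation step with `S₁ := inclPlaceAdelic v₁ '' {u | ∀ w, det u_w = 1}`. [cite: Rogawski1990, §13.3 pp. 202–203] [cite: BorelJacquet1979, §4.6] [cite: PlatonovRapinchuk1994, §7.4] -/
theorem forall_toContRep_inclPlaceAdelic_apply_eq_self_of_eq_mk_ofChar
    {μ₂ : Measure (adelicGroupData ↥(maximalRealSubfield L) L (IsCMField.complexConj L) 2 (Matrix.of fun i j : Fin 2 => if i.val + j.val + 1 = 2 then (1 : L) else 0)).automorphicQuotient}
    [(adelicGroupData ↥(maximalRealSubfield L) L (IsCMField.complexConj L) 2 (Matrix.of fun i j : Fin 2 => if i.val + j.val + 1 = 2 then (1 : L) else 0)).IsAutomorphicMeasure μ₂]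
    (π₂ : ∀ v : HeightOneSpectrum (𝓞 ↥(maximalRealSubfield L)), IrrClass ((cmDatum L 2 (Matrix.of fun i j : Fin 2 => if i.val + j.val + 1 = 2 then (1 : L) else 0)).Local v))
    (P : DiscreteAutomorphicRep (adelicGroupData ↥(maximalRealSubfield L) L (IsCMField.complexConj L) 2 (Matrix.of fun i j : Fin 2 => if i.val + j.val + 1 = 2 then (1 : L) else 0)) μ₂)
    {W : Type} [AddCommGroup W] [Module ℂ W]
    (σ : Representation ℂ (finAdelic ↥(maximalRealSubfield L) L (IsCMField.complexConj L) 2 (Matrix.of fun i j : Fin 2 => if i.val + j.val + 1 = 2 then (1 : L) else 0)) W)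
    (hirr : σ.IsIrreducible) (hsm : σ.IsSmooth) (ι : σ.IntertwiningMap P.finRep) (hι : Function.Injective ι)
    (v₁ : HeightOneSpectrum (𝓞 ↥(maximalRealSubfield L)))
    (hconst : ∀ c₀ : IrrClass ↥(localPi L (IsCMField.complexConj L) 2 (Matrix.of fun i j : Fin 2 => if i.val + j.val + 1 = 2 then (1 : L) else 0) v₁),
      c₀.IsConstituentOf (σ.comp (inclPlace ↥(maximalRealSubfield L) L (IsCMField.complexConj L) 2 (Matrix.of fun i j : Fin 2 => if i.val + j.val + 1 = 2 then (1 : L) else 0) v₁)) ↔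
        c₀ = IrrClass.comap (localPiEquiv L (IsCMField.complexConj L) 2 (Matrix.of fun i j : Fin 2 => if i.val + j.val + 1 = 2 then (1 : L) else 0) v₁) (π₂ v₁))
    (χ' : (cmDatum L 2 (Matrix.of fun i j : Fin 2 => if i.val + j.val + 1 = 2 then (1 : L) else 0)).Local v₁ →* ℂˣ)
    (hχ' : IsOpen ((χ'.ker : Subgroup ((cmDatum L 2 (Matrix.of fun i j : Fin 2 => if i.val + j.val + 1 = 2 then (1 : L) else 0)).Local v₁)) :
      Set ((cmDatum L 2 (Matrix.of fun i j : Fin 2 => if i.val + j.val + 1 = 2 then (1 : L) else 0)).Local v₁)))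
    (hv : π₂ v₁ = IrrClass.mk (SmoothIrrep.ofChar χ' hχ'))
    (u : ↥(localPi L (IsCMField.complexConj L) 2 (Matrix.of fun i j : Fin 2 => if i.val + j.val + 1 = 2 then (1 : L) else 0) v₁))
    (hu : ∀ w : PlacesOver L v₁, (((u : LocalGLPi L 2 v₁) w : GL (Fin 2) (w.1.adicCompletion L)) : Matrix (Fin 2) (Fin 2) (w.1.adicCompletion L)).det = 1)
    (f : ↥P.space.toSubmodule) :
    P.space.toContRep (inclPlaceAdelic ↥(maximalRealSubfield L) L (IsCMField.complexConj L) 2 (Matrix.of fun i j : Fin 2 => if i.val + j.val + 1 = 2 then (1 : L) else 0) v₁ u) f = f := by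
  haveI : σ.IsIrreducible := hirr
  haveI : Nontrivial W := IrrClass.nontrivial_of_isIrreducible σ
  exact DiscreteAutomorphicRep.toContRep_inclPlaceAdelic_apply_eq_self_of_forall_det_eq_one L (IsCMField.complexConj L) 2 _ P σ ι hι v₁
    (fun u' hu' x => forall_apply_inclPlace_eq_self_of_eq_mk_ofChar π₂ P σ hsm ι hι v₁ hconst χ' hχ' hv u' hu' x) u hu f

/-- **The `S₁`-form** (the letter of ★ p850740 `DiscreteAutomorphicRep.toContRep_apply_eq_self_of_subset_closure`'s `hfix`): every element of the SET
`S₁ := inclPlaceAdelic v₁ '' {u | ∀ w, det u_w = 1}` fixes every vector of `P`. [cite: Rogawski1990, §13.3 pp. 202–203] [cite: PlatonovRapinchuk1994, §7.4] -/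
theorem forall_mem_image_inclPlaceAdelic_apply_eq_self_of_eq_mk_ofChar
    {μ₂ : Measure (adelicGroupData ↥(maximalRealSubfield L) L (IsCMField.complexConj L) 2 (Matrix.of fun i j : Fin 2 => if i.val + j.val + 1 = 2 then (1 : L) else 0)).automorphicQuotient}
    [(adelicGroupData ↥(maximalRealSubfield L) L (IsCMField.complexConj L) 2 (Matrix.of fun i j : Fin 2 => if i.val + j.val + 1 = 2 then (1 : L) else 0)).IsAutomorphicMeasure μ₂]
    (π₂ : ∀ v : HeightOneSpectrum (𝓞 ↥(maximalRealSubfield L)), IrrClass ((cmDatum L 2 (Matrix.of fun i j : Fin 2 => if i.val + j.val + 1 = 2 then (1 : L) else 0)).Local v))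
    (P : DiscreteAutomorphicRep (adelicGroupData ↥(maximalRealSubfield L) L (IsCMField.complexConj L) 2 (Matrix.of fun i j : Fin 2 => if i.val + j.val + 1 = 2 then (1 : L) else 0)) μ₂)
    {W : Type} [AddCommGroup W] [Module ℂ W]
    (σ : Representation ℂ (finAdelic ↥(maximalRealSubfield L) L (IsCMField.complexConj L) 2 (Matrix.of fun i j : Fin 2 => if i.val + j.val + 1 = 2 then (1 : L) else 0)) W)
    (hirr : σ.IsIrreducible) (hsm : σ.IsSmooth) (ι : σ.IntertwiningMap P.finRep) (hι : Function.Injective ι)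
    (v₁ : HeightOneSpectrum (𝓞 ↥(maximalRealSubfield L)))
    (hconst : ∀ c₀ : IrrClass ↥(localPi L (IsCMField.complexConj L) 2 (Matrix.of fun i j : Fin 2 => if i.val + j.val + 1 = 2 then (1 : L) else 0) v₁),
      c₀.IsConstituentOf (σ.comp (inclPlace ↥(maximalRealSubfield L) L (IsCMField.complexConj L) 2 (Matrix.of fun i j : Fin 2 => if i.val + j.val + 1 = 2 then (1 : L) else 0) v₁)) ↔
        c₀ = IrrClass.comap (localPiEquiv L (IsCMField.complexConj L) 2 (Matrix.of fun i j : Fin 2 => if i.val + j.val + 1 = 2 then (1 : L) else 0) v₁) (π₂ v₁))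
    (χ' : (cmDatum L 2 (Matrix.of fun i j : Fin 2 => if i.val + j.val + 1 = 2 then (1 : L) else 0)).Local v₁ →* ℂˣ)
    (hχ' : IsOpen ((χ'.ker : Subgroup ((cmDatum L 2 (Matrix.of fun i j : Fin 2 => if i.val + j.val + 1 = 2 then (1 : L) else 0)).Local v₁)) :
      Set ((cmDatum L 2 (Matrix.of fun i j : Fin 2 => if i.val + j.val + 1 = 2 then (1 : L) else 0)).Local v₁)))
    (hv : π₂ v₁ = IrrClass.mk (SmoothIrrep.ofChar χ' hχ')) :
    ∀ s ∈ inclPlaceAdelic ↥(maximalRealSubfield L) L (IsCMField.complexConj L) 2 (Matrix.of fun i j : Fin 2 => if i.val + j.val + 1 = 2 then (1 : L) else 0) v₁ ''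
        {u : ↥(localPi L (IsCMField.complexConj L) 2 (Matrix.of fun i j : Fin 2 => if i.val + j.val + 1 = 2 then (1 : L) else 0) v₁) |
          ∀ w : PlacesOver L v₁, (((u : LocalGLPi L 2 v₁) w : GL (Fin 2) (w.1.adicCompletion L)) : Matrix (Fin 2) (Fin 2) (w.1.adicCompletion L)).det = 1},
      ∀ f : ↥P.space.toSubmodule, P.space.toContRep s f = f := by
  rintro _ ⟨u, hu, rfl⟩ f
  exact forall_toContRep_inclPlaceAdelic_apply_eq_self_of_eq_mk_ofChar π₂ P σ hirr hsm ι hι v₁ hconst χ' hχ' hv u hu f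

end Summit.HodgeConjecture.HodgeConjecture.Cruxes.H413.F0P3cPKtupleSaU2LocalFix

end
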